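import Summits.QuantumFields.YangMills.Theorems.BalabanUVNodesN15CurvedGluingSmoothCutDressedGluedAdjointGauged
import Summits.QuantumFields.YangMills.Theorems.BalabanUVNodesN15CurvedGluingSmoothCutDressedFarDefect
import HarnessLib

/-!
# THE ADJOINT FAR-DEFECT ROWS OF THE DRESSED SMOOTH-CUT CUBE: `X∘F∘M_h = 0` EXACTLY and `X∘[F, M_h] = X∘M_h∘N_V∘(1 − M_χ)` — the two far rows FILE 163 ∕ 165 display (`hFX`, `hFK`),
# discharged from the cube's input cut-off `N = NM_ψ`, the partition's insertions and ONE displayed far letter `M_hN_V(1 − M_χ) ≤ θ_Fe^{−ρ_Fd}` (dag-n15-c g19, FILE 166; N15 = NE2, s1 road (c))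

Cell `pub-ymgap`, seat `pub-ymgap-dag-n15-c` (R134 (a); HUMAN RULING D-0062), generation 19.  `bears_on: R4∕N15 · K3⁸ SpineGivenEndpointR13SepCoPHV (stmt-QuantumFields-27366)`.
Filed `--kind proof --supports stmt-QuantumFields-27366 --as helper` — COUNT-NEUTRAL.  Theorems only; 0 `def`, 0 `sorry`.  Imports BY NAME FILE 163 `…SmoothCutDressedGluedAdjointGauged`
(through it FILE 148 `projO_dressedV_fix_right`, file 34 `hasMaj_smoothCutDressed_loc₂` ∕ `hasMaj_smoothCut_flat` ∕ `hasMaj_jet_smoothCut_flat`, file 23 `hasMaj_dressedV_pair`, dag-n15-c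
`hasMaj_comp_exp_out`) and dag-n15-w3 file 49 `…SmoothCutDressedFarDefect` (`jetCut_comp_jet_mulOp_comp`, `jet_comp_eq_stack`, `stack_comp`).  Nothing in the tree is modified; nothing restated.

WHY.  dag-n15-w3's files 49∕50 discharge the DIRECT far rows `M_hFX = 0` and `[F, M_h]X = far tail` of the per-cube covariance identity `Δ^{u_k} = model_k + F_k`
(`F_k = −(V̂_f − M_ψV̂_fC_χ)∘jet`, file 49 `localOp_eq_cut_add_farDefect`).  The ADJOINT capstones FILE 163 ∕ 165 (entry 2 `𝒢∘∇^{U*}` of (3.42)) display the TRANSPOSED rows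
`X_k∘F_k∘M_{h_k} ≤ 1_S1_S·ε_F` and `X_k∘[F_k, M_{h_k}] ≤ 1_S(y)·θ_F` (g18 FINDING (x)).  THIS FILE discharges them: the dressed cube absorbs the flat cube's INPUT cut-off (`X∘M_ψ = X` from
`N∘M_ψ = N` by FILE 148's right fixed point), so `X∘F∘M_h = −X∘V̂_f∘(1 − C_χ)∘jet∘M_h = 0` (the jet of `M_h`-cut fields is `C_χ`-localized, file 49); and `X∘[F, M_h] = −X∘M_h∘F =
X∘M_h∘V̂_f∘(1 − C_χ)∘jet`, whose species part vanishes POINTWISE (`h(1 − χ) = 0`: the species `unstackM C A` reads the pair field at the output point) leaving the genuinely far term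
`X∘M_h∘N_V∘(1 − M_χ)` — ONE displayed letter, zero when `N_V = 0` (the small-field class of FILES 129–146).

WHAT.  §1 (generic dressing algebra, FILE 148's context): `projO_dressedV_comp_mulOp` (`X∘M_ψ = X`), ★ `projO_dressedV_comp_farDefect_mulOp` (`X∘F∘M_h = 0`), ★ `projO_dressedV_comp_commOp_farDefect`
(`X∘[F, M_h] = X∘M_h∘V̂_f∘(1 − C)∘jet`), ★ `localOp_split_of_cutForm` (`Δ = model + F` from the global and cut forms — FILES 167–169's `hcov`); §2 (the pair carrier): `mulOp_comp_unstackM_comp_sub_jetCut` (species part `= 0`), `projO_none_sub_jetCut_comp_jet`, ★ `mulOp_comp_cutPert_comp_sub_jetCut_comp_jet`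
(`M_h(unstackM C A + N_Vpr₀)(1 − C_χ)jet = M_hN_V(1 − M_χ)`); §3 (the smooth-cut cube, file 34's data): ★★ `hasMaj_smoothCutDressed_comp_farDefect_mulOp` (FILE 163's `hFX` with `ε_F = 0`),
★★ `smoothCutDressed_comp_commOp_farDefect_eq`, ★★★ `hasMaj_smoothCutDressed_comp_commOp_farDefect` (FILE 163's `hFK`: `X∘[F, M_h] ≤ 1_S(y)·(B̄′θ_Fc_r)e^{−ρ₃d}`, `B̄′ = β̄(1 − β̄Rc_r²)⁻¹`).

HONEST FRAMING ∕ LIMITS.  Finite-dimensional operator algebra and block-majorant bookkeeping over LANDED theorems; proves NO estimate of a concrete propagator; nothing of [B5]∕[B6]∕[B9]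
asserted ((2.91)–(2.93) p.239, (2.133)–(2.136) p.247, (3.34)–(3.35) p.396, (3.62)–(3.65) pp.402–403 = SHAPES ∕ MECHANISM).  NE2 for non-abelian `G(U)` NOT proved (C-N15-1); N15 is
booked «discharged AS CONSUMED at the U-blind v7 pin» (№253) — this file belongs to the located burden's typed home (road (c), FLAG №13) and moves NO count; K3⁸ skeleton untouched;
one finite 𝕋⁴ at fixed ε — NOT infinite volume, NOT OS on ℝ⁴, NOT a mass gap, NOT Clay.  Restate-immune (no Theses import).
-/

set_option autoImplicit false

noncomputable section
open scoped BigOperators Matrix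
open Finset

namespace Summit.QuantumFields.YangMills.BalabanUVNodes.N15.Gluing

open Literature.MathematicalPhysics.QuantumFieldTheory.Balaban1983to89
open Literature.MathematicalPhysics.QuantumFieldTheory.Balaban1983to89.B11SectG (BlockNorm HasMaj RowSum hasMaj_zero)
open Literature.MathematicalPhysics.QuantumFieldTheory.Balaban1983to89.B6RandomWalk (Triangle254)
open Literature.MathematicalPhysics.QuantumFieldTheory.Balaban1983to89.B6Prop26Gluing (mulOp mulOp_apply ind ind_nonneg ind_le_one)
open Summit.QuantumFields.YangMills.BalabanUVNodes.N15.MatrixSpecies (mmulOp mmulOp_apply liftBlk liftEquiv liftEquiv_apply liftEquiv_symm_apply)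
open Summit.QuantumFields.YangMills.BalabanUVNodes.N15.BackgroundLayer (fgrad bgrad stack projO projO_apply unstackM unstackM_apply bgPropV blkPair projO_none_comp_stack)
open Summit.QuantumFields.YangMills.BalabanUVNodes.N15.CurvedSpecies (hasMaj_smoothCutDressed_loc₂ hasMaj_smoothCut_flat hasMaj_jet_smoothCut_flat hasMaj_dressedV_pair
  jetCut_comp_jet_mulOp_comp jet_comp_eq_stack stack_comp localOp_eq_cut_add_farDefect)

/-! ## §1 The dressed cube absorbs the flat cube's input cut-off; the adjoint far rows, algebra -/

section Algebra

variable {Y K : Type} [Fintype Y] [Fintype K] [DecidableEq Y] [DecidableEq K] {G₀ : (Y → ℝ) →ₗ[ℝ] (Y → ℝ)} {D Dq : K → (Y → ℝ) →ₗ[ℝ] (Y → ℝ)}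
  {V : (Y × Option K → ℝ) →ₗ[ℝ] (Y → ℝ)}

/-- **THE DRESSED CUBE ABSORBS THE FLAT CUBE's INPUT CUT-OFF**: `G₀∘M_ψ = G₀` (and `D_j = D̃_j∘G₀`) ⟹ `X∘M_ψ = X` for `X = pr₀((1 − ŜV̂)⁻¹Ŝ)` (FILE 148's right fixed point `X = G₀ + X∘V̂∘Ŝ`).
[cite: Balaban1985BackgroundPropagators, (3.63)–(3.65) pp.402–403 (the cube propagator reads sources in the cube: shape)] -/
theorem projO_dressedV_comp_mulOp (hD : ∀ j, D j = Dq j ∘ₗ G₀) (hunit : IsUnit (1 - LinearMap.toMatrix' (stack G₀ D ∘ₗ V))) {ψ : Y → ℝ} (hGψ : G₀ ∘ₗ mulOp ψ = G₀) :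
    (projO none ∘ₗ bgPropV (stack G₀ D) V) ∘ₗ mulOp ψ = projO none ∘ₗ bgPropV (stack G₀ D) V := by
  have hS : stack G₀ D ∘ₗ mulOp ψ = stack G₀ D := by
    rw [stack_comp, hGψ]
    congr 1
    funext j
    rw [hD j, LinearMap.comp_assoc, hGψ]
  have hfix := projO_dressedV_fix_right (G₀ := G₀) (D := D) (V := V) hunit
  have h2 : (V ∘ₗ stack G₀ D) ∘ₗ mulOp ψ = V ∘ₗ stack G₀ D := by rw [LinearMap.comp_assoc, hS]
  conv_lhs => rw [hfix]
  rw [LinearMap.add_comp, hGψ, LinearMap.comp_assoc, h2, ← hfix]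

/-- ★ **THE ADJOINT FAR ROW VANISHES EXACTLY**: `X∘F∘M_h = 0` for `F = −(V̂_f − M_ψV̂_fC)∘jet`, given `X∘M_ψ = X` (previous lemma) and the `C`-localization of the jet of `M_h`-cut fields
`C∘jet∘M_h = jet∘M_h`. [cite: Balaban1985BackgroundPropagators, (3.63)–(3.65) pp.402–403 (mechanism); Balaban1984PropagatorsII, (2.93) p.239 (shape, transposed)] -/
theorem projO_dressedV_comp_farDefect_mulOp (hD : ∀ j, D j = Dq j ∘ₗ G₀) (hunit : IsUnit (1 - LinearMap.toMatrix' (stack G₀ D ∘ₗ V))) {ψ h : Y → ℝ} {c : Y × Option K → ℝ}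
    (hGψ : G₀ ∘ₗ mulOp ψ = G₀) (Vf : (Y × Option K → ℝ) →ₗ[ℝ] (Y → ℝ)) (hY : mulOp c ∘ₗ (stack LinearMap.id Dq ∘ₗ mulOp h) = stack LinearMap.id Dq ∘ₗ mulOp h) :
    (projO none ∘ₗ bgPropV (stack G₀ D) V) ∘ₗ (-((Vf - mulOp ψ ∘ₗ Vf ∘ₗ mulOp c) ∘ₗ stack LinearMap.id Dq)) ∘ₗ mulOp h = 0 := by
  have hX := projO_dressedV_comp_mulOp hD hunit hGψ
  have h1 : (projO none ∘ₗ bgPropV (stack G₀ D) V) ∘ₗ (-((Vf - mulOp ψ ∘ₗ Vf ∘ₗ mulOp c) ∘ₗ stack LinearMap.id Dq)) ∘ₗ mulOp h =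
      -((projO none ∘ₗ bgPropV (stack G₀ D) V) ∘ₗ Vf ∘ₗ (stack LinearMap.id Dq ∘ₗ mulOp h) -
        ((projO none ∘ₗ bgPropV (stack G₀ D) V) ∘ₗ mulOp ψ) ∘ₗ Vf ∘ₗ (mulOp c ∘ₗ (stack LinearMap.id Dq ∘ₗ mulOp h))) := by
    simp only [LinearMap.neg_comp, LinearMap.comp_neg, LinearMap.sub_comp, LinearMap.comp_sub, LinearMap.comp_assoc]
  rw [h1, hX, hY, sub_self, neg_zero]

/-- ★ **THE ADJOINT COMMUTATOR FAR ROW, EXACTLY**: with moreover `M_hM_ψ = M_h`: `X∘[F, M_h] = X∘M_h∘V̂_f∘(1 − C)∘jet` (`[F, M_h] = FM_h − M_hF`, the first term is the previous lemma).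
[cite: Balaban1984PropagatorsII, (2.92)–(2.93) p.239 (shape, transposed); Balaban1985BackgroundPropagators, (3.63)–(3.65) pp.402–403 (mechanism)] -/
theorem projO_dressedV_comp_commOp_farDefect (hD : ∀ j, D j = Dq j ∘ₗ G₀) (hunit : IsUnit (1 - LinearMap.toMatrix' (stack G₀ D ∘ₗ V))) {ψ h : Y → ℝ} {c : Y × Option K → ℝ}
    (hGψ : G₀ ∘ₗ mulOp ψ = G₀) (hhψ : mulOp h ∘ₗ mulOp ψ = mulOp h) (Vf : (Y × Option K → ℝ) →ₗ[ℝ] (Y → ℝ))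
    (hY : mulOp c ∘ₗ (stack LinearMap.id Dq ∘ₗ mulOp h) = stack LinearMap.id Dq ∘ₗ mulOp h) :
    (projO none ∘ₗ bgPropV (stack G₀ D) V) ∘ₗ commOp (-((Vf - mulOp ψ ∘ₗ Vf ∘ₗ mulOp c) ∘ₗ stack LinearMap.id Dq)) h =
      (projO none ∘ₗ bgPropV (stack G₀ D) V) ∘ₗ mulOp h ∘ₗ Vf ∘ₗ (LinearMap.id - mulOp c) ∘ₗ stack LinearMap.id Dq := by
  have h0 := projO_dressedV_comp_farDefect_mulOp hD hunit hGψ Vf hY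
  have h1 : (projO none ∘ₗ bgPropV (stack G₀ D) V) ∘ₗ commOp (-((Vf - mulOp ψ ∘ₗ Vf ∘ₗ mulOp c) ∘ₗ stack LinearMap.id Dq)) h =
      (projO none ∘ₗ bgPropV (stack G₀ D) V) ∘ₗ (-((Vf - mulOp ψ ∘ₗ Vf ∘ₗ mulOp c) ∘ₗ stack LinearMap.id Dq)) ∘ₗ mulOp h -
        (projO none ∘ₗ bgPropV (stack G₀ D) V) ∘ₗ mulOp h ∘ₗ (-((Vf - mulOp ψ ∘ₗ Vf ∘ₗ mulOp c) ∘ₗ stack LinearMap.id Dq)) := by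
    simp only [commOp, LinearMap.comp_sub, LinearMap.comp_assoc]
  rw [h1, h0, zero_sub]
  have h2 : mulOp h ∘ₗ (-((Vf - mulOp ψ ∘ₗ Vf ∘ₗ mulOp c) ∘ₗ stack LinearMap.id Dq)) = -(mulOp h ∘ₗ Vf ∘ₗ (LinearMap.id - mulOp c) ∘ₗ stack LinearMap.id Dq) := by
    have h3 : mulOp h ∘ₗ (mulOp ψ ∘ₗ Vf ∘ₗ mulOp c) = mulOp h ∘ₗ Vf ∘ₗ mulOp c := by rw [← LinearMap.comp_assoc, hhψ]
    rw [LinearMap.comp_neg, LinearMap.sub_comp, LinearMap.comp_sub, ← LinearMap.comp_assoc (stack LinearMap.id Dq) (mulOp ψ ∘ₗ Vf ∘ₗ mulOp c) (mulOp h), h3]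
    simp only [LinearMap.sub_comp, LinearMap.comp_sub, LinearMap.id_comp, LinearMap.comp_assoc]
  rw [h2, LinearMap.comp_neg, neg_neg]

omit [Fintype Y] [Fintype K] [DecidableEq Y] [DecidableEq K] in
/-- ★ **THE GLOBAL OPERATOR READ IN A CUBE = THE CUBE's MODEL OPERATOR + THE FAR DEFECT**: `Δ = L − V̂_f∘jet` and the cut form `M_ψV̂_fC = V̂` ⟹ `Δ = (L − V̂∘jet) + F`,
`F = −(V̂_f − M_ψV̂_fC)∘jet` (file 49 `localOp_eq_cut_add_farDefect` with the cut form substituted in the model operator ONLY) — FILES 167–169's `hcov` at `u ≡ 1`.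
[cite: Balaban1985BackgroundPropagators, (3.34)–(3.35) p.396, (3.50)–(3.53) p.400 (shapes)] -/
theorem localOp_split_of_cutForm {L Δ : (Y → ℝ) →ₗ[ℝ] (Y → ℝ)} {Vf Vh : (Y × Option K → ℝ) →ₗ[ℝ] (Y → ℝ)} {ψ : Y → ℝ} {c : Y × Option K → ℝ}
    (hΔ : Δ = L - Vf ∘ₗ stack LinearMap.id Dq) (hVc : mulOp ψ ∘ₗ Vf ∘ₗ mulOp c = Vh) :
    Δ = (L - Vh ∘ₗ stack LinearMap.id Dq) + -((Vf - mulOp ψ ∘ₗ Vf ∘ₗ mulOp c) ∘ₗ stack LinearMap.id Dq) := by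
  rw [hΔ, ← hVc]
  exact localOp_eq_cut_add_farDefect L Vf ψ

end Algebra

/-! ## §2 On the pair carrier: the species part of the far commutator row vanishes pointwise; the nonlocal part reads `M_hN_V(1 − M_χ)` -/

section Pair

variable {X ι J : Type} [Fintype ι] [Fintype J] (τ : J → X ≃ X) (n : ℝ)

omit [Fintype J] in
/-- `h(1 − χ) = 0` pointwise (`M_χM_h = M_h`) ⟹ `M_h∘unstackM C A∘(1 − C_χ) = 0`: the matrix-coefficient species reads the pair field AT THE OUTPUT POINT. [cite: Balaban1985BackgroundPropagators, (3.50)–(3.52) p.400 (first-order perturbation: shape)] -/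
theorem mulOp_comp_unstackM_comp_sub_jetCut {K : Type} [Fintype K] (C : X → Matrix ι ι ℝ) (A : K → X → Matrix ι ι ℝ) {χX hX : X → ℝ}
    (hχh : mulOp (fun p : X × ι => χX p.1) ∘ₗ mulOp (fun p : X × ι => hX p.1) = mulOp (fun p : X × ι => hX p.1)) :
    mulOp (fun p : X × ι => hX p.1) ∘ₗ unstackM C A ∘ₗ (LinearMap.id - mulOp (fun q : (X × ι) × Option K => χX q.1.1)) = 0 := by
  refine LinearMap.ext fun f => funext fun p => ?_
  have h2 := congrFun (LinearMap.congr_fun hχh (fun _ => (1 : ℝ))) p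
  simp only [LinearMap.comp_apply, mulOp_apply, mul_one] at h2
  have hx : hX p.1 * (1 - χX p.1) = 0 := by
    calc hX p.1 * (1 - χX p.1) = hX p.1 - χX p.1 * hX p.1 := by ring
      _ = 0 := by rw [h2, sub_self]
  simp only [LinearMap.comp_apply, LinearMap.zero_apply, Pi.zero_apply, mulOp_apply, unstackM_apply, LinearMap.sub_apply, LinearMap.id_apply, Pi.sub_apply]
  have e1 : ∀ a b : ℝ, a * (b - χX p.1 * b) = (1 - χX p.1) * (a * b) := fun a b => by ring
  simp only [e1, ← Finset.mul_sum]
  rw [← mul_add, ← mul_assoc, hx, zero_mul]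

omit [Fintype ι] [Fintype J] in
/-- `pr₀∘(1 − C_χ)∘jet = 1 − M_χ` (`pr₀∘jet = 1`, `pr₀∘C_χ = M_χ∘pr₀`). [folklore] -/
theorem projO_none_sub_jetCut_comp_jet (χX : X → ℝ) :
    projO (none : Option (J ⊕ J)) ∘ₗ (LinearMap.id - mulOp (fun q : (X × ι) × Option (J ⊕ J) => χX q.1.1)) ∘ₗ
        stack LinearMap.id (fun j => Sum.elim (fun μ => fgrad n (liftEquiv (τ μ) ι)) (fun μ => bgrad n (liftEquiv (τ μ) ι)) j) =
      LinearMap.id - mulOp (fun p : X × ι => χX p.1) := by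
  refine LinearMap.ext fun f => funext fun p => ?_
  simp only [LinearMap.comp_apply, projO_apply, LinearMap.sub_apply, LinearMap.id_apply, Pi.sub_apply, mulOp_apply, BackgroundLayer.stack_apply_none]

/-- ★ **THE FAR COMMUTATOR ROW's RIGHT FACTOR**: for the cube perturbation in `unstackM` form, `M_h∘(unstackM C A + N_V∘pr₀)∘(1 − C_χ)∘jet = M_h∘N_V∘(1 − M_χ)` — the species part vanishes,
the nonlocal part reads the field OUTSIDE `χ` and returns it ON `supp h`. [cite: Balaban1985BackgroundPropagators, (3.34)–(3.35) p.396, (3.76)–(3.77) pp.405–406 (shapes)] -/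
theorem mulOp_comp_cutPert_comp_sub_jetCut_comp_jet (C : X → Matrix ι ι ℝ) (A : J ⊕ J → X → Matrix ι ι ℝ) (NV : (X × ι → ℝ) →ₗ[ℝ] (X × ι → ℝ)) {χX hX : X → ℝ}
    (hχh : mulOp (fun p : X × ι => χX p.1) ∘ₗ mulOp (fun p : X × ι => hX p.1) = mulOp (fun p : X × ι => hX p.1)) :
    mulOp (fun p : X × ι => hX p.1) ∘ₗ (unstackM C A + NV ∘ₗ projO (none : Option (J ⊕ J))) ∘ₗ (LinearMap.id - mulOp (fun q : (X × ι) × Option (J ⊕ J) => χX q.1.1)) ∘ₗ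
        stack LinearMap.id (fun j => Sum.elim (fun μ => fgrad n (liftEquiv (τ μ) ι)) (fun μ => bgrad n (liftEquiv (τ μ) ι)) j) =
      mulOp (fun p : X × ι => hX p.1) ∘ₗ NV ∘ₗ (LinearMap.id - mulOp (fun p : X × ι => χX p.1)) := by
  have h0 := mulOp_comp_unstackM_comp_sub_jetCut (K := J ⊕ J) C A hχh
  rw [LinearMap.add_comp, LinearMap.comp_add, ← LinearMap.comp_assoc _ (LinearMap.id - mulOp (fun q : (X × ι) × Option (J ⊕ J) => χX q.1.1)) (unstackM C A),
    ← LinearMap.comp_assoc _ (unstackM C A ∘ₗ (LinearMap.id - mulOp (fun q : (X × ι) × Option (J ⊕ J) => χX q.1.1))) (mulOp fun p : X × ι => hX p.1), h0, LinearMap.zero_comp, zero_add]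
  simp only [LinearMap.comp_assoc]
  rw [projO_none_sub_jetCut_comp_jet τ n χX]

end Pair

/-! ## §3 The smooth-cut dressed cube: the two adjoint far rows of FILES 163 ∕ 165 -/

section SmoothCut

variable {X ι J : Type} [Fintype X] [DecidableEq X] [Fintype ι] [DecidableEq ι] [Fintype J] [DecidableEq J] {g : B6.Geometry} (blk : X → g.Site) (τ : J → X ≃ X) (n : ℝ)
  {σ cr : ℝ} {N : (X × ι → ℝ) →ₗ[ℝ] (X × ι → ℝ)} {V : ((X × ι) × Option (J ⊕ J) → ℝ) →ₗ[ℝ] (X × ι → ℝ)} {NV : (X × ι → ℝ) →ₗ[ℝ] (X × ι → ℝ)} {C : X → Matrix ι ι ℝ}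
  {A : J ⊕ J → X → Matrix ι ι ℝ} {χX χtX ψX hX : X → ℝ} {S : Set g.Site} {β β₁ ct δ : ℝ}

omit [Fintype X] [DecidableEq X] [Fintype ι] [DecidableEq ι] [Fintype J] [DecidableEq J] in
/-- the smooth-cut stack absorbs the input cut-off: `N∘M_ψ = N` ⟹ `(M_χ̃N)∘M_ψ = M_χ̃N`. [folklore] -/
theorem smoothCut_comp_mulOp_in (hNψ : N ∘ₗ mulOp (fun p : X × ι => ψX p.1) = N) :
    (mulOp (fun p : X × ι => χtX p.1) ∘ₗ N) ∘ₗ mulOp (fun p : X × ι => ψX p.1) = mulOp (fun p : X × ι => χtX p.1) ∘ₗ N := by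
  rw [LinearMap.comp_assoc, hNψ]

/-- ★★ **FILE 163's `hFX` ROW WITH `ε_F = 0`**: for the dressed smooth-cut cube `X` (file 34's data, any perturbation `V̂` behind it, `N = NM_ψ`), ANY full perturbation `V̂_f`, its cut
`Ṽ = M_ψV̂_fC_χ`, `F = −(V̂_f − Ṽ)∘jet`, and a partition function `h` with `h`, its shifts and `∇^±h` supported in `{χ = 1}`:  `X∘F∘M_h ≤ 1_S1_S·(0·e^{−ρ₃d})` (it is `0`).
[cite: Balaban1985BackgroundPropagators, (3.63)–(3.65) pp.402–403 (mechanism); Balaban1984PropagatorsII, (2.93) p.239 (shape, transposed)] -/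
theorem hasMaj_smoothCutDressed_comp_farDefect_mulOp
    (htri : Triangle254 g) (hd : ∀ a b : g.Site, 0 ≤ g.dist a b) (hrow : RowSum g σ cr) (hσ : 0 ≤ σ) {ρ₁ ρ₂ δV R : ℝ} (hβ : 0 ≤ β) (hβ₁ : 0 ≤ β₁)
    (hct : 0 ≤ ct) (hR : 0 ≤ R) (hcr : 0 ≤ cr) (hσρ : σ ≤ ρ₁) (hρ₁V : ρ₁ ≤ δV) (hρ₁G : ρ₁ + σ ≤ δ) (hρ₂ : 0 ≤ ρ₂) (hρ₂₁ : ρ₂ + σ ≤ ρ₁)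
    (hχt : ∀ x, |χtX x| ≤ 1)
    (hdχt : ∀ μ p, |fgrad n (liftEquiv (τ μ) ι) (fun p : X × ι => χtX p.1) p| ≤ ct) (hdχtb : ∀ μ p, |bgrad n (liftEquiv (τ μ) ι) (fun p : X × ι => χtX p.1) p| ≤ ct)
    (hsub : mulOp (fun p : X × ι => χtX p.1) ∘ₗ mulOp (fun p : X × ι => χX p.1) = mulOp (fun p : X × ι => χtX p.1))
    (hs : ∀ μ, mulOp ((fun p : X × ι => χtX p.1) ∘ (liftEquiv (τ μ) ι)) ∘ₗ mulOp (fun p : X × ι => χX p.1) = mulOp ((fun p : X × ι => χtX p.1) ∘ (liftEquiv (τ μ) ι)))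
    (hsb : ∀ μ, mulOp ((fun p : X × ι => χtX p.1) ∘ (liftEquiv (τ μ) ι).symm) ∘ₗ mulOp (fun p : X × ι => χX p.1) = mulOp ((fun p : X × ι => χtX p.1) ∘ (liftEquiv (τ μ) ι).symm))
    (hdd : ∀ μ, mulOp (fgrad n (liftEquiv (τ μ) ι) (fun p : X × ι => χtX p.1)) ∘ₗ mulOp (fun p : X × ι => χX p.1) = mulOp (fgrad n (liftEquiv (τ μ) ι) (fun p : X × ι => χtX p.1)))
    (hddb : ∀ μ, mulOp (bgrad n (liftEquiv (τ μ) ι) (fun p : X × ι => χtX p.1)) ∘ₗ mulOp (fun p : X × ι => χX p.1) = mulOp (bgrad n (liftEquiv (τ μ) ι) (fun p : X × ι => χtX p.1)))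
    (hNψ : N ∘ₗ mulOp (fun p : X × ι => ψX p.1) = N)
    (hcut : HasMaj (BlockNorm.ofBlocks g (liftBlk blk ι)) (BlockNorm.ofBlocks g (liftBlk blk ι)) (mulOp (fun p : X × ι => χX p.1) ∘ₗ N) (fun y y' => ind S y * ind S y' * (β * Real.exp (-(δ * g.dist y y')))))
    (hcutF : ∀ μ, HasMaj (BlockNorm.ofBlocks g (liftBlk blk ι)) (BlockNorm.ofBlocks g (liftBlk blk ι)) (mulOp (fun p : X × ι => χX p.1) ∘ₗ (fgrad n (liftEquiv (τ μ) ι) ∘ₗ N)) (fun y y' => ind S y * ind S y' * (β₁ * Real.exp (-(δ * g.dist y y')))))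
    (hcutB : ∀ μ, HasMaj (BlockNorm.ofBlocks g (liftBlk blk ι)) (BlockNorm.ofBlocks g (liftBlk blk ι)) (mulOp (fun p : X × ι => χX p.1) ∘ₗ (bgrad n (liftEquiv (τ μ) ι) ∘ₗ N)) (fun y y' => ind S y * ind S y' * (β₁ * Real.exp (-(δ * g.dist y y')))))
    (hV : HasMaj (BlockNorm.ofBlocks g (blkPair (liftBlk blk ι))) (BlockNorm.ofBlocks g (liftBlk blk ι)) V (fun y y' => R * Real.exp (-(δV * g.dist y y'))))
    (hq : (β + (β₁ + ct * β)) * (R * cr) * cr < 1)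
    (hχh : mulOp (fun p : X × ι => χX p.1) ∘ₗ mulOp (fun p : X × ι => hX p.1) = mulOp (fun p : X × ι => hX p.1))
    (hhs' : ∀ μ, mulOp (fun p : X × ι => χX p.1) ∘ₗ mulOp ((fun p : X × ι => hX p.1) ∘ (liftEquiv (τ μ) ι)) = mulOp ((fun p : X × ι => hX p.1) ∘ (liftEquiv (τ μ) ι)))
    (hhsb' : ∀ μ, mulOp (fun p : X × ι => χX p.1) ∘ₗ mulOp ((fun p : X × ι => hX p.1) ∘ (liftEquiv (τ μ) ι).symm) = mulOp ((fun p : X × ι => hX p.1) ∘ (liftEquiv (τ μ) ι).symm))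
    (hhdd' : ∀ μ, mulOp (fun p : X × ι => χX p.1) ∘ₗ mulOp (fgrad n (liftEquiv (τ μ) ι) (fun p : X × ι => hX p.1)) = mulOp (fgrad n (liftEquiv (τ μ) ι) (fun p : X × ι => hX p.1)))
    (hhddb' : ∀ μ, mulOp (fun p : X × ι => χX p.1) ∘ₗ mulOp (bgrad n (liftEquiv (τ μ) ι) (fun p : X × ι => hX p.1)) = mulOp (bgrad n (liftEquiv (τ μ) ι) (fun p : X × ι => hX p.1)))
    (Vf : (((X × ι) × Option (J ⊕ J)) → ℝ) →ₗ[ℝ] (X × ι → ℝ)) (ρ₃ : ℝ) :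
    HasMaj (BlockNorm.ofBlocks g (liftBlk blk ι)) (BlockNorm.ofBlocks g (liftBlk blk ι))
      ((projO none ∘ₗ bgPropV (stack (mulOp (fun p : X × ι => χtX p.1) ∘ₗ N) (fun j => Sum.elim (fun μ => fgrad n (liftEquiv (τ μ) ι)) (fun μ => bgrad n (liftEquiv (τ μ) ι)) j ∘ₗ (mulOp (fun p : X × ι => χtX p.1) ∘ₗ N))) V) ∘ₗ
        (-((Vf - mulOp (fun p : X × ι => ψX p.1) ∘ₗ Vf ∘ₗ mulOp (fun q : (X × ι) × Option (J ⊕ J) => χX q.1.1)) ∘ₗ stack LinearMap.id (fun j => Sum.elim (fun μ => fgrad n (liftEquiv (τ μ) ι)) (fun μ => bgrad n (liftEquiv (τ μ) ι)) j))) ∘ₗ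
        mulOp (fun p : X × ι => hX p.1))
      (fun y y' => ind S y * ind S y' * (0 * Real.exp (-(ρ₃ * g.dist y y')))) := by
  have hβb : 0 ≤ β + (β₁ + ct * β) := by positivity
  have hG := hasMaj_smoothCut_flat blk (S := S) hβ hβ₁ hct hχt hsub hcut
  have hD := hasMaj_jet_smoothCut_flat blk τ n (S := S) hβ hβ₁ hct hχt hdχt hdχtb hs hsb hdd hddb hcut hcutF hcutB
  have hunit := (hasMaj_dressedV_pair blk htri hd hrow hσ hβb hR hcr hσρ hρ₁V hρ₁G hρ₂ hρ₂₁ hG hD hV hq).1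
  have hY := jetCut_comp_jet_mulOp_comp τ n hχh hhs' hhsb' hhdd' hhddb' (LinearMap.id : (X × ι → ℝ) →ₗ[ℝ] (X × ι → ℝ))
  rw [LinearMap.comp_id] at hY
  rw [projO_dressedV_comp_farDefect_mulOp (fun _ => rfl) hunit (smoothCut_comp_mulOp_in hNψ) Vf hY]
  exact (hasMaj_zero _ _).mono fun y y' => le_of_eq (by ring)

/-- ★★ **THE ADJOINT COMMUTATOR FAR ROW OF THE SMOOTH-CUT DRESSED CUBE, EXACTLY**: with the cube perturbation's full form `V̂_f = unstackM C A + N_V∘pr₀` and `M_hM_ψ = M_h`: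
`X∘[F, M_h] = X∘M_h∘N_V∘(1 − M_χ)`. [cite: Balaban1985BackgroundPropagators, (3.34)–(3.35) p.396, (3.63)–(3.65) pp.402–403, (3.76)–(3.77) pp.405–406 (mechanism); Balaban1984PropagatorsII, (2.93) p.239 (shape, transposed)] -/
theorem smoothCutDressed_comp_commOp_farDefect_eq
    (htri : Triangle254 g) (hd : ∀ a b : g.Site, 0 ≤ g.dist a b) (hrow : RowSum g σ cr) (hσ : 0 ≤ σ) {ρ₁ ρ₂ δV R : ℝ} (hβ : 0 ≤ β) (hβ₁ : 0 ≤ β₁)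
    (hct : 0 ≤ ct) (hR : 0 ≤ R) (hcr : 0 ≤ cr) (hσρ : σ ≤ ρ₁) (hρ₁V : ρ₁ ≤ δV) (hρ₁G : ρ₁ + σ ≤ δ) (hρ₂ : 0 ≤ ρ₂) (hρ₂₁ : ρ₂ + σ ≤ ρ₁)
    (hχt : ∀ x, |χtX x| ≤ 1)
    (hdχt : ∀ μ p, |fgrad n (liftEquiv (τ μ) ι) (fun p : X × ι => χtX p.1) p| ≤ ct) (hdχtb : ∀ μ p, |bgrad n (liftEquiv (τ μ) ι) (fun p : X × ι => χtX p.1) p| ≤ ct)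
    (hsub : mulOp (fun p : X × ι => χtX p.1) ∘ₗ mulOp (fun p : X × ι => χX p.1) = mulOp (fun p : X × ι => χtX p.1))
    (hs : ∀ μ, mulOp ((fun p : X × ι => χtX p.1) ∘ (liftEquiv (τ μ) ι)) ∘ₗ mulOp (fun p : X × ι => χX p.1) = mulOp ((fun p : X × ι => χtX p.1) ∘ (liftEquiv (τ μ) ι)))
    (hsb : ∀ μ, mulOp ((fun p : X × ι => χtX p.1) ∘ (liftEquiv (τ μ) ι).symm) ∘ₗ mulOp (fun p : X × ι => χX p.1) = mulOp ((fun p : X × ι => χtX p.1) ∘ (liftEquiv (τ μ) ι).symm))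
    (hdd : ∀ μ, mulOp (fgrad n (liftEquiv (τ μ) ι) (fun p : X × ι => χtX p.1)) ∘ₗ mulOp (fun p : X × ι => χX p.1) = mulOp (fgrad n (liftEquiv (τ μ) ι) (fun p : X × ι => χtX p.1)))
    (hddb : ∀ μ, mulOp (bgrad n (liftEquiv (τ μ) ι) (fun p : X × ι => χtX p.1)) ∘ₗ mulOp (fun p : X × ι => χX p.1) = mulOp (bgrad n (liftEquiv (τ μ) ι) (fun p : X × ι => χtX p.1)))
    (hNψ : N ∘ₗ mulOp (fun p : X × ι => ψX p.1) = N)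
    (hcut : HasMaj (BlockNorm.ofBlocks g (liftBlk blk ι)) (BlockNorm.ofBlocks g (liftBlk blk ι)) (mulOp (fun p : X × ι => χX p.1) ∘ₗ N) (fun y y' => ind S y * ind S y' * (β * Real.exp (-(δ * g.dist y y')))))
    (hcutF : ∀ μ, HasMaj (BlockNorm.ofBlocks g (liftBlk blk ι)) (BlockNorm.ofBlocks g (liftBlk blk ι)) (mulOp (fun p : X × ι => χX p.1) ∘ₗ (fgrad n (liftEquiv (τ μ) ι) ∘ₗ N)) (fun y y' => ind S y * ind S y' * (β₁ * Real.exp (-(δ * g.dist y y')))))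
    (hcutB : ∀ μ, HasMaj (BlockNorm.ofBlocks g (liftBlk blk ι)) (BlockNorm.ofBlocks g (liftBlk blk ι)) (mulOp (fun p : X × ι => χX p.1) ∘ₗ (bgrad n (liftEquiv (τ μ) ι) ∘ₗ N)) (fun y y' => ind S y * ind S y' * (β₁ * Real.exp (-(δ * g.dist y y')))))
    (hV : HasMaj (BlockNorm.ofBlocks g (blkPair (liftBlk blk ι))) (BlockNorm.ofBlocks g (liftBlk blk ι)) V (fun y y' => R * Real.exp (-(δV * g.dist y y'))))
    (hq : (β + (β₁ + ct * β)) * (R * cr) * cr < 1)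
    (hhψ : mulOp (fun p : X × ι => hX p.1) ∘ₗ mulOp (fun p : X × ι => ψX p.1) = mulOp (fun p : X × ι => hX p.1))
    (hχh : mulOp (fun p : X × ι => χX p.1) ∘ₗ mulOp (fun p : X × ι => hX p.1) = mulOp (fun p : X × ι => hX p.1))
    (hhs' : ∀ μ, mulOp (fun p : X × ι => χX p.1) ∘ₗ mulOp ((fun p : X × ι => hX p.1) ∘ (liftEquiv (τ μ) ι)) = mulOp ((fun p : X × ι => hX p.1) ∘ (liftEquiv (τ μ) ι)))
    (hhsb' : ∀ μ, mulOp (fun p : X × ι => χX p.1) ∘ₗ mulOp ((fun p : X × ι => hX p.1) ∘ (liftEquiv (τ μ) ι).symm) = mulOp ((fun p : X × ι => hX p.1) ∘ (liftEquiv (τ μ) ι).symm))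
    (hhdd' : ∀ μ, mulOp (fun p : X × ι => χX p.1) ∘ₗ mulOp (fgrad n (liftEquiv (τ μ) ι) (fun p : X × ι => hX p.1)) = mulOp (fgrad n (liftEquiv (τ μ) ι) (fun p : X × ι => hX p.1)))
    (hhddb' : ∀ μ, mulOp (fun p : X × ι => χX p.1) ∘ₗ mulOp (bgrad n (liftEquiv (τ μ) ι) (fun p : X × ι => hX p.1)) = mulOp (bgrad n (liftEquiv (τ μ) ι) (fun p : X × ι => hX p.1))) :
    (projO none ∘ₗ bgPropV (stack (mulOp (fun p : X × ι => χtX p.1) ∘ₗ N) (fun j => Sum.elim (fun μ => fgrad n (liftEquiv (τ μ) ι)) (fun μ => bgrad n (liftEquiv (τ μ) ι)) j ∘ₗ (mulOp (fun p : X × ι => χtX p.1) ∘ₗ N))) V) ∘ₗ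
        commOp (-(((unstackM C A + NV ∘ₗ projO none) - mulOp (fun p : X × ι => ψX p.1) ∘ₗ (unstackM C A + NV ∘ₗ projO none) ∘ₗ mulOp (fun q : (X × ι) × Option (J ⊕ J) => χX q.1.1)) ∘ₗ
          stack LinearMap.id (fun j => Sum.elim (fun μ => fgrad n (liftEquiv (τ μ) ι)) (fun μ => bgrad n (liftEquiv (τ μ) ι)) j))) (fun p : X × ι => hX p.1) =
      (projO none ∘ₗ bgPropV (stack (mulOp (fun p : X × ι => χtX p.1) ∘ₗ N) (fun j => Sum.elim (fun μ => fgrad n (liftEquiv (τ μ) ι)) (fun μ => bgrad n (liftEquiv (τ μ) ι)) j ∘ₗ (mulOp (fun p : X × ι => χtX p.1) ∘ₗ N))) V) ∘ₗ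
        (mulOp (fun p : X × ι => hX p.1) ∘ₗ NV ∘ₗ (LinearMap.id - mulOp (fun p : X × ι => χX p.1))) := by
  have hβb : 0 ≤ β + (β₁ + ct * β) := by positivity
  have hG := hasMaj_smoothCut_flat blk (S := S) hβ hβ₁ hct hχt hsub hcut
  have hD := hasMaj_jet_smoothCut_flat blk τ n (S := S) hβ hβ₁ hct hχt hdχt hdχtb hs hsb hdd hddb hcut hcutF hcutB
  have hunit := (hasMaj_dressedV_pair blk htri hd hrow hσ hβb hR hcr hσρ hρ₁V hρ₁G hρ₂ hρ₂₁ hG hD hV hq).1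
  have hY := jetCut_comp_jet_mulOp_comp τ n hχh hhs' hhsb' hhdd' hhddb' (LinearMap.id : (X × ι → ℝ) →ₗ[ℝ] (X × ι → ℝ))
  rw [LinearMap.comp_id] at hY
  rw [projO_dressedV_comp_commOp_farDefect (fun _ => rfl) hunit (smoothCut_comp_mulOp_in hNψ) hhψ _ hY, ← mulOp_comp_cutPert_comp_sub_jetCut_comp_jet τ n C A NV hχh]

/-- ★★★ **FILE 163's `hFK` ROW FROM ONE FAR LETTER**: with, in addition, the cuts' supports over `S`, `ρ₃ + σ ≤ ρ₂`, `ρ₃ ≤ ρ_F`, and the DISPLAYED far letter of the nonlocal perturbation from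
OUTSIDE `χ` to `supp h`, `M_hN_V(1 − M_χ) ≤ θ_Fe^{−ρ_Fd}`:  `X∘[F, M_h] ≤ 1_S(y)·(B̄′θ_Fc_r)e^{−ρ₃d}`, `B̄′ = β̄(1 − β̄Rc_r²)⁻¹`, `β̄ = β + (β₁ + c̃β)`.
[cite: Balaban1985BackgroundPropagators, (3.34)–(3.35) p.396, (3.63)–(3.65) pp.402–403, (3.76)–(3.77) pp.405–406 (mechanism); Balaban1984PropagatorsII, (2.93) p.239, (2.133)–(2.135) p.247 (shapes, transposed)] -/
theorem hasMaj_smoothCutDressed_comp_commOp_farDefect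
    (htri : Triangle254 g) (hd : ∀ a b : g.Site, 0 ≤ g.dist a b) (hrow : RowSum g σ cr) (hσ : 0 ≤ σ) {ρ₁ ρ₂ δV R : ℝ} (hβ : 0 ≤ β) (hβ₁ : 0 ≤ β₁)
    (hct : 0 ≤ ct) (hR : 0 ≤ R) (hcr : 0 ≤ cr) (hσρ : σ ≤ ρ₁) (hρ₁V : ρ₁ ≤ δV) (hρ₁G : ρ₁ + σ ≤ δ) (hρ₂ : 0 ≤ ρ₂) (hρ₂₁ : ρ₂ + σ ≤ ρ₁)
    (hSχ : ∀ x, χX x ≠ 0 → blk x ∈ S) (hSψ : ∀ x, ψX x ≠ 0 → blk x ∈ S) (hχt : ∀ x, |χtX x| ≤ 1)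
    (hdχt : ∀ μ p, |fgrad n (liftEquiv (τ μ) ι) (fun p : X × ι => χtX p.1) p| ≤ ct) (hdχtb : ∀ μ p, |bgrad n (liftEquiv (τ μ) ι) (fun p : X × ι => χtX p.1) p| ≤ ct)
    (hsub : mulOp (fun p : X × ι => χtX p.1) ∘ₗ mulOp (fun p : X × ι => χX p.1) = mulOp (fun p : X × ι => χtX p.1))
    (hχ : mulOp (fun p : X × ι => χX p.1) ∘ₗ mulOp (fun p : X × ι => χtX p.1) = mulOp (fun p : X × ι => χtX p.1))
    (hs : ∀ μ, mulOp ((fun p : X × ι => χtX p.1) ∘ (liftEquiv (τ μ) ι)) ∘ₗ mulOp (fun p : X × ι => χX p.1) = mulOp ((fun p : X × ι => χtX p.1) ∘ (liftEquiv (τ μ) ι)))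
    (hsb : ∀ μ, mulOp ((fun p : X × ι => χtX p.1) ∘ (liftEquiv (τ μ) ι).symm) ∘ₗ mulOp (fun p : X × ι => χX p.1) = mulOp ((fun p : X × ι => χtX p.1) ∘ (liftEquiv (τ μ) ι).symm))
    (hdd : ∀ μ, mulOp (fgrad n (liftEquiv (τ μ) ι) (fun p : X × ι => χtX p.1)) ∘ₗ mulOp (fun p : X × ι => χX p.1) = mulOp (fgrad n (liftEquiv (τ μ) ι) (fun p : X × ι => χtX p.1)))
    (hddb : ∀ μ, mulOp (bgrad n (liftEquiv (τ μ) ι) (fun p : X × ι => χtX p.1)) ∘ₗ mulOp (fun p : X × ι => χX p.1) = mulOp (bgrad n (liftEquiv (τ μ) ι) (fun p : X × ι => χtX p.1)))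
    (hNψ : N ∘ₗ mulOp (fun p : X × ι => ψX p.1) = N)
    (hcut : HasMaj (BlockNorm.ofBlocks g (liftBlk blk ι)) (BlockNorm.ofBlocks g (liftBlk blk ι)) (mulOp (fun p : X × ι => χX p.1) ∘ₗ N) (fun y y' => ind S y * ind S y' * (β * Real.exp (-(δ * g.dist y y')))))
    (hcutF : ∀ μ, HasMaj (BlockNorm.ofBlocks g (liftBlk blk ι)) (BlockNorm.ofBlocks g (liftBlk blk ι)) (mulOp (fun p : X × ι => χX p.1) ∘ₗ (fgrad n (liftEquiv (τ μ) ι) ∘ₗ N)) (fun y y' => ind S y * ind S y' * (β₁ * Real.exp (-(δ * g.dist y y')))))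
    (hcutB : ∀ μ, HasMaj (BlockNorm.ofBlocks g (liftBlk blk ι)) (BlockNorm.ofBlocks g (liftBlk blk ι)) (mulOp (fun p : X × ι => χX p.1) ∘ₗ (bgrad n (liftEquiv (τ μ) ι) ∘ₗ N)) (fun y y' => ind S y * ind S y' * (β₁ * Real.exp (-(δ * g.dist y y')))))
    (hV : HasMaj (BlockNorm.ofBlocks g (blkPair (liftBlk blk ι))) (BlockNorm.ofBlocks g (liftBlk blk ι)) V (fun y y' => R * Real.exp (-(δV * g.dist y y'))))
    (hq : (β + (β₁ + ct * β)) * (R * cr) * cr < 1)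
    {θF ρ₃ ρF : ℝ} (hθF : 0 ≤ θF) (hρ₃ : 0 ≤ ρ₃) (hρ₃₂ : ρ₃ + σ ≤ ρ₂) (hρF : ρ₃ ≤ ρF)
    (hhψ : mulOp (fun p : X × ι => hX p.1) ∘ₗ mulOp (fun p : X × ι => ψX p.1) = mulOp (fun p : X × ι => hX p.1))
    (hχh : mulOp (fun p : X × ι => χX p.1) ∘ₗ mulOp (fun p : X × ι => hX p.1) = mulOp (fun p : X × ι => hX p.1))
    (hhs' : ∀ μ, mulOp (fun p : X × ι => χX p.1) ∘ₗ mulOp ((fun p : X × ι => hX p.1) ∘ (liftEquiv (τ μ) ι)) = mulOp ((fun p : X × ι => hX p.1) ∘ (liftEquiv (τ μ) ι)))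
    (hhsb' : ∀ μ, mulOp (fun p : X × ι => χX p.1) ∘ₗ mulOp ((fun p : X × ι => hX p.1) ∘ (liftEquiv (τ μ) ι).symm) = mulOp ((fun p : X × ι => hX p.1) ∘ (liftEquiv (τ μ) ι).symm))
    (hhdd' : ∀ μ, mulOp (fun p : X × ι => χX p.1) ∘ₗ mulOp (fgrad n (liftEquiv (τ μ) ι) (fun p : X × ι => hX p.1)) = mulOp (fgrad n (liftEquiv (τ μ) ι) (fun p : X × ι => hX p.1)))
    (hhddb' : ∀ μ, mulOp (fun p : X × ι => χX p.1) ∘ₗ mulOp (bgrad n (liftEquiv (τ μ) ι) (fun p : X × ι => hX p.1)) = mulOp (bgrad n (liftEquiv (τ μ) ι) (fun p : X × ι => hX p.1)))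
    (hfar : HasMaj (BlockNorm.ofBlocks g (liftBlk blk ι)) (BlockNorm.ofBlocks g (liftBlk blk ι)) (mulOp (fun p : X × ι => hX p.1) ∘ₗ NV ∘ₗ (LinearMap.id - mulOp (fun p : X × ι => χX p.1)))
      (fun y y' => θF * Real.exp (-(ρF * g.dist y y')))) :
    HasMaj (BlockNorm.ofBlocks g (liftBlk blk ι)) (BlockNorm.ofBlocks g (liftBlk blk ι))
      ((projO none ∘ₗ bgPropV (stack (mulOp (fun p : X × ι => χtX p.1) ∘ₗ N) (fun j => Sum.elim (fun μ => fgrad n (liftEquiv (τ μ) ι)) (fun μ => bgrad n (liftEquiv (τ μ) ι)) j ∘ₗ (mulOp (fun p : X × ι => χtX p.1) ∘ₗ N))) V) ∘ₗ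
        commOp (-(((unstackM C A + NV ∘ₗ projO none) - mulOp (fun p : X × ι => ψX p.1) ∘ₗ (unstackM C A + NV ∘ₗ projO none) ∘ₗ mulOp (fun q : (X × ι) × Option (J ⊕ J) => χX q.1.1)) ∘ₗ
          stack LinearMap.id (fun j => Sum.elim (fun μ => fgrad n (liftEquiv (τ μ) ι)) (fun μ => bgrad n (liftEquiv (τ μ) ι)) j))) (fun p : X × ι => hX p.1))
      (fun y y' => ind S y * (((β + (β₁ + ct * β)) * (1 - (β + (β₁ + ct * β)) * (R * cr) * cr)⁻¹) * θF * cr * Real.exp (-(ρ₃ * g.dist y y')))) := by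
  have hβb : 0 ≤ β + (β₁ + ct * β) := by positivity
  have hqi : 0 ≤ (1 - (β + (β₁ + ct * β)) * (R * cr) * cr)⁻¹ := inv_nonneg.2 (by linarith)
  have hB : 0 ≤ ((β + (β₁ + ct * β)) * (1 - (β + (β₁ + ct * β)) * (R * cr) * cr)⁻¹) := mul_nonneg hβb hqi
  have hX0 := hasMaj_smoothCutDressed_loc₂ blk τ n htri hd hrow hσ hβ hβ₁ hct hR hcr hσρ hρ₁V hρ₁G hρ₂ hρ₂₁ hSχ hSψ hχt hdχt hdχtb hsub hχ hs hsb hdd hddb hNψ hcut hcutF hcutB hV hq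
  rw [smoothCutDressed_comp_commOp_farDefect_eq blk τ n htri hd hrow hσ hβ hβ₁ hct hR hcr hσρ hρ₁V hρ₁G hρ₂ hρ₂₁ hχt hdχt hdχtb hsub hs hsb hdd hddb hNψ hcut hcutF hcutB hV hq hhψ hχh
    hhs' hhsb' hhdd' hhddb']
  exact (hasMaj_comp_exp_out (blk₂ := liftBlk blk ι) htri hd hrow hB hθF hρ₃ hρF hρ₃₂ hX0 hfar).mono fun y y' => le_of_eq (by ring)

end SmoothCut

end Summit.QuantumFields.YangMills.BalabanUVNodes.N15.Gluing

end
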